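import Literature.Computability.Cryptography.HILLHashedFunction
import Literature.Computability.MetaComplexity.DistProblems
import Literature.Computability.Complexity.FoldBricks
import Literature.Computability.Complexity.BinarySubtraction
import HarnessLib

/-!
# Constructible, indistinguishable, far-apart ensembles give one-way functions, II: the two-sampler function `f̃`

Second file of the discharge of `Goldreich2001_owfExist_of_indistinguishable_farApart`
(`IndistinguishableFarEnsembles.lean`; Goldreich 2001, §3.8 Exercise 11). Goldreich's guideline considers, for
the two samplers `S₀, S₁` of the constructible ensembles `X, Y`, the function `(σ, r) ↦ S_σ(r)` ("the
hypothesis implies the existence of a distributionally one-way function", cf. Goldreich 2010, Exercise 2.8,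
step 2: "Consider the generator `G(σ, r) = (σ, S_σ(r))`"). This file renders that function in the tree's machine
model as a **length-preserving** polynomial-time string function `Params.ftil` defined on ALL input lengths,
the inner function of the hashed candidate `HILL.g ftil` of the next files:

* `FarApartOWF.Params`: the two samplers `S0, S1 : RandAlg ℕ (List Bool)` (input `1ⁿ`) with polynomials
  `pc` (≥ both coin counts), `po` (≥ the output lengths on `≤ pc n` coins), `pd` (the far-apartness polynomial,
  only used to make the levels large); `tLen n = ⌊log₂ pc(n)⌋ + 1` (width of a coin-count guess),
  `R n = pc n` (coin block), the designed length `Q n` and the parameter `nPar L` of an input length `L`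
  (largest `n ≤ L` with `Q n ≤ L`).
* `Params.core n x` — the map at parameter `n` on `x = a ‖ b ‖ σ ‖ r ‖ junk` (`|a| = |b| = tLen n`, `σ` one bit,
  `|r| = R n`): with the guess `j = ⟦σ ? b : a⟧` it outputs `a ‖ b ‖ ⟨z ↾ cap, 0…0⟩`, `z = S_σ(1ⁿ; r ↾ j)`, the
  `boolPair` code zero-padded to the input length (`cap` only guards totality: sampler outputs are short).
  As in `CommitmentOneWay.lean`, the coin counts `ℓ_σ(n) = S_σ.coinLen n` are arbitrary polynomially bounded
  functions, so `f̃` reads GUESSES of them off its input and copies the guesses to the output: on the **slice**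
  `a = bits ℓ₀(n)`, `b = bits ℓ₁(n)` (density `4^{-tLen n}`) the output is an honest sample of `X n` (`σ = 0`) or
  `Y n` (`σ = 1`), and preimages of slice images lie in the slice (`core_eq_core_iff`).
* `Params.ftil x = core (nPar |x|) x` when `Q (nPar |x|) ≤ |x|` (else `x`): length preserving at every length
  (`isLengthPreserving_ftil`).
* `Params.zOfRest`: the sample read off the `rest = σ ‖ r ‖ junk` part on the slice, `core_slice`;
  the slice averages `uniformAvg_slice_indicator` (the `σ = 0` half of the rest-space samples `X n` exactly:
  `E_rest[[σ = 0] φ(z)] = ½ E_{r₀ ← U_{ℓ₀}}[φ(S₀(1ⁿ; r₀))]`, and likewise for `σ = 1`).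
* `FProg`: `ftil ∈ FP` (a clocked search for `nPar`, the guess decoding with `lenBinF`/`binToUnaryFn`, the
  samplers' machines behind a pair normaliser, `boolPair` padding) — the tree's brick algebra, no machine
  programmed.

## References

* O. Goldreich, *Foundations of Cryptography I*, CUP 2001, §3.8 Exercise 11 (guideline), §2.2.3.2 (functions
  defined on some lengths only), Def. 3.2.5 (polynomial-time-constructible ensembles).
* O. Goldreich, *A Primer on Pseudorandom Generators*, AMS 2010, Exercise 2.8 (step 2, `G(σ, r) = (σ, S_σ(r))`).
-/

namespace Literature.Computability.Cryptography

namespace FarApartOWF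

open Filter Finset Polynomial _root_.Computability Complexity

noncomputable section

/-- **The data of the construction**: two samplers on input `1ⁿ` and three polynomials — `pc` bounding both
coin counts, `po` bounding the output lengths on at most `pc n` coins, `pd` the far-apartness polynomial.
[cite: Goldreich2001, §3.8 Exercise 11 (guideline: the two samplers)] -/
structure Params where
  /-- sampler of `X` -/
  S0 : RandAlg ℕ (List Bool)
  /-- sampler of `Y` -/
  S1 : RandAlg ℕ (List Bool)
  /-- bound on both coin counts -/
  pc : Polynomial ℕ
  /-- bound on the output lengths -/
  po : Polynomial ℕ
  /-- the far-apartness polynomial -/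
  pd : Polynomial ℕ

namespace Params

variable (P : Params)

/-! ### Parameters -/

/-- `t(n) = ⌊log₂ pc(n)⌋ + 1`: the width of a guess of a coin count `ℓ ≤ pc n < 2^{t(n)}`. [folklore] -/
def tLen (n : ℕ) : ℕ := HILL.bLen (P.pc.eval n)

/-- `R(n) = pc(n)`: the length of the coin block. [folklore] -/
def R (n : ℕ) : ℕ := P.pc.eval n

/-- The designed input length `Q(n) = n + 3 pc(n) + 2 po(n) + 3 pd(n) + 8`, as a polynomial. [folklore] -/
noncomputable def Qpoly : Polynomial ℕ := X + C 3 * P.pc + C 2 * P.po + C 3 * P.pd + C 8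

/-- `Q(n)`. [folklore] -/
def Q (n : ℕ) : ℕ := P.Qpoly.eval n

/-- The parameter of an input length: the largest `n ≤ L` with `Q n ≤ L`. [cite: Goldreich2001, §2.2.3.2] -/
def nPar (L : ℕ) : ℕ := Nat.findGreatest (fun n => P.Q n ≤ L) L

/-- The sampler of bit `σ`. [folklore] -/
def S (σ : Bool) : RandAlg ℕ (List Bool) := if σ then P.S1 else P.S0

/-- `ℓ_σ(n)`: the (true) coin count of `S_σ` on `1ⁿ`. [folklore] -/
def ell (σ : Bool) (n : ℕ) : ℕ := (P.S σ).coinLen n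

/-- `S 0 = S0`. [folklore] -/
@[simp] theorem S_false : P.S false = P.S0 := rfl
/-- `S 1 = S1`. [folklore] -/
@[simp] theorem S_true : P.S true = P.S1 := rfl

/-- `Q n = n + 3 pc n + 2 po n + 3 pd n + 8`. [folklore] -/
theorem Q_eq (n : ℕ) : P.Q n = n + 3 * P.pc.eval n + 2 * P.po.eval n + 3 * P.pd.eval n + 8 := by
  simp [Q, Qpoly]

/-- `Q` is strictly increasing. [folklore] -/
theorem Q_strictMono : StrictMono P.Q := by
  intro a b hab
  rw [Q_eq, Q_eq]
  have h1 := natPoly_eval_mono P.pc hab.le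
  have h2 := natPoly_eval_mono P.po hab.le
  have h3 := natPoly_eval_mono P.pd hab.le
  omega

/-- `n ≤ Q n`. [folklore] -/
theorem le_Q (n : ℕ) : n ≤ P.Q n := by rw [Q_eq]; omega

/-- `pc n < 2^{t n}`. [folklore] -/
theorem lt_two_pow_tLen (n : ℕ) : P.pc.eval n < 2 ^ P.tLen n := HILL.lt_two_pow_bLen _

/-- `2^{t n} ≤ 2 pc n + 2`. [folklore] -/
theorem two_pow_tLen_le (n : ℕ) : 2 ^ P.tLen n ≤ 2 * P.pc.eval n + 2 := HILL.two_pow_bLen_le _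

/-- `t n ≤ pc n + 1`. [folklore] -/
theorem tLen_le (n : ℕ) : P.tLen n ≤ P.pc.eval n + 1 := HILL.bLen_le_succ _

/-- **The fields fit**: `2 t(n) + 1 + R(n) + 1 ≤ Q n`. [folklore] -/
theorem fields_le_Q (n : ℕ) : 2 * P.tLen n + 1 + P.R n + 1 ≤ P.Q n := by
  have := P.tLen_le n; rw [Q_eq, R]; omega

/-- **The code fits**: `2 t(n) + 2 po(n) + 4 ≤ Q n`. [folklore] -/
theorem code_le_Q (n : ℕ) : 2 * P.tLen n + (2 * P.po.eval n + 4) ≤ P.Q n := by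
  have := P.tLen_le n; rw [Q_eq]; omega

/-- `3 pd(n) ≤ Q n`. [folklore] -/
theorem three_mul_pd_le_Q (n : ℕ) : 3 * P.pd.eval n ≤ P.Q n := by rw [Q_eq]; omega

/-- Specification of `nPar`: `Q (nPar L) ≤ L` as soon as `Q 0 ≤ L`. [folklore] -/
theorem Q_nPar_le {L : ℕ} (hL : P.Q 0 ≤ L) : P.Q (P.nPar L) ≤ L :=
  Nat.findGreatest_spec (P := fun n => P.Q n ≤ L) (Nat.zero_le L) hL

/-- `nPar L ≤ L`. [folklore] -/
theorem nPar_le (L : ℕ) : P.nPar L ≤ L := Nat.findGreatest_le L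

/-- Specification of `nPar`: `L < Q (nPar L + 1)`. [folklore] -/
theorem lt_Q_nPar_succ (L : ℕ) : L < P.Q (P.nPar L + 1) := by
  by_contra h
  push Not at h
  have hle : P.nPar L + 1 ≤ L := (P.le_Q _).trans h
  have := Nat.le_findGreatest (P := fun n => P.Q n ≤ L) hle h
  unfold nPar at this
  omega

/-- `nPar` inverts `Q` on the windows: `Q n ≤ L < Q (n+1)` gives `nPar L = n`. [folklore] -/
theorem nPar_eq {n L : ℕ} (h1 : P.Q n ≤ L) (h2 : L < P.Q (n + 1)) : P.nPar L = n := by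
  have hmono := P.Q_strictMono
  have ha := P.Q_nPar_le ((hmono.monotone (Nat.zero_le n)).trans h1)
  have hb := P.lt_Q_nPar_succ L
  have h3 : P.nPar L < n + 1 := hmono.lt_iff_lt.1 (ha.trans_lt h2)
  have h4 : n < P.nPar L + 1 := hmono.lt_iff_lt.1 (h1.trans_lt hb)
  omega

/-- `nPar L → ∞`. [folklore] -/
theorem tendsto_nPar : Tendsto P.nPar atTop atTop := by
  refine tendsto_atTop_atTop.2 fun n => ⟨P.Q n, fun L hL => ?_⟩
  by_contra h
  push Not at h
  have hb := P.lt_Q_nPar_succ L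
  have : P.Q (P.nPar L + 1) ≤ P.Q n := P.Q_strictMono.monotone (by omega)
  omega

/-- `nPar` is monotone. [folklore] -/
theorem nPar_mono : Monotone P.nPar := by
  intro a b hab
  by_contra h
  push Not at h
  have h1 := P.lt_Q_nPar_succ b
  rcases lt_or_ge a (P.Q 0) with ha | ha
  · have : P.nPar a = 0 := by
      unfold nPar
      rw [Nat.findGreatest_eq_zero_iff]
      intro k hk _ hQ
      exact absurd (lt_of_lt_of_le ha ((P.Q_strictMono.monotone (Nat.zero_le k)).trans hQ)) (lt_irrefl _)
    omega
  · have h2 := P.Q_nPar_le ha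
    have : P.Q (P.nPar b + 1) ≤ P.Q (P.nPar a) := P.Q_strictMono.monotone (by omega)
    omega

/-! ### Binary codes of a prescribed width -/

/-- The `t`-bit little-endian code of `v` (`v < 2^t`): `encodeNat v` padded with high zeros. [folklore] -/
def bitsT (t v : ℕ) : List Bool := encodeNat v ++ List.replicate (t - (encodeNat v).length) false

/-- `⟦bitsT t v⟧ = v`. [folklore] -/
@[simp] theorem bitsToNat_bitsT (t v : ℕ) : bitsToNat (bitsT t v) = v := by
  rw [bitsT, bitsToNat_append_replicate_false, bitsToNat_encodeNat]

/-- `|bitsT t v| = t` for `v < 2^t`. [folklore] -/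
theorem length_bitsT {t v : ℕ} (hv : v < 2 ^ t) : (bitsT t v).length = t := by
  have h : (encodeNat v).length ≤ t := by rw [TM2Pass.length_encodeNat_eq_size]; exact Nat.size_le.2 hv
  rw [bitsT, List.length_append, List.length_replicate]; omega

/-- Strings of equal length with equal values are equal. [folklore] -/
theorem eq_of_bitsToNat_eq : ∀ {v w : List Bool}, v.length = w.length → bitsToNat v = bitsToNat w → v = w
  | [], [], _, _ => rfl
  | [], _ :: _, h, _ => by simp at h
  | _ :: _, [], h, _ => by simp at h
  | a :: v, b :: w, hl, hv => by
    simp only [bitsToNat, List.length_cons, Nat.succ.injEq] at hl hv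
    have hab : a = b := by
      rcases a <;> rcases b <;> simp at hv ⊢ <;> omega
    subst hab
    have : bitsToNat v = bitsToNat w := by omega
    rw [eq_of_bitsToNat_eq hl this]

/-- A `t`-bit string is the code of its value. [folklore] -/
theorem bitsT_bitsToNat {t : ℕ} {u : List Bool} (hu : u.length = t) : bitsT t (bitsToNat u) = u :=
  eq_of_bitsToNat_eq (by rw [length_bitsT (hu ▸ bitsToNat_lt u), hu]) (bitsToNat_bitsT _ _)

/-! ### The map at parameter `n` -/

section Core

variable (n : ℕ)

/-- The first guess field `a = x ↾ t`. [folklore] -/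
def aOf (x : List Bool) : List Bool := x.take (P.tLen n)
/-- The second guess field `b`. [folklore] -/
def bOf (x : List Bool) : List Bool := (x.drop (P.tLen n)).take (P.tLen n)
/-- The selector bit `σ = x[2t]`. [folklore] -/
def sgOf (x : List Bool) : Bool := x.getD (2 * P.tLen n) false
/-- The coin block `r` (`R n` bits after the selector). [folklore] -/
def rOf (x : List Bool) : List Bool := (x.drop (2 * P.tLen n + 1)).take (P.R n)
/-- The guess in force: `j = ⟦σ ? b : a⟧`. [folklore] -/
def jOf (x : List Bool) : ℕ := bitsToNat (if P.sgOf n x then P.bOf n x else P.aOf n x)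
/-- The sample `z = S_σ(1ⁿ; r ↾ j)`. [cite: Goldreich2001, §3.8 Exercise 11 (guideline)] -/
def zOf (x : List Bool) : List Bool := (P.S (P.sgOf n x)).run n ((P.rOf n x).take (P.jOf n x))
/-- The width of the code field, `W = L − 2t`. [folklore] -/
def W (L : ℕ) : ℕ := L - 2 * P.tLen n
/-- The cap on the encoded sample, `⌊(W − 2)/2⌋` (inactive on sampler outputs). [folklore] -/
def cap (L : ℕ) : ℕ := (P.W n L - 2) / 2
/-- **The fixed-width code** of a string: `⟨z ↾ cap, 0^{W − 2|z ↾ cap| − 2}⟩`, of length exactly `W`. [folklore] -/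
def enc (L : ℕ) (z : List Bool) : List Bool :=
  boolPair (z.take (P.cap n L)) (List.replicate (P.W n L - (2 * (z.take (P.cap n L)).length + 2)) false)

/-- **The map at parameter `n`**: `core n x = a ‖ b ‖ enc(z)`. [cite: Goldreich2001, §3.8 Exercise 11 (guideline: `(σ, r) ↦ S_σ(r)`)] -/
def core (x : List Bool) : List Bool := P.aOf n x ++ P.bOf n x ++ P.enc n x.length (P.zOf n x)

variable {n}

/-- `|enc L z| = W L` (for `W L ≥ 2`). [folklore] -/
theorem length_enc {L : ℕ} (hW : 2 ≤ P.W n L) (z : List Bool) : (P.enc n L z).length = P.W n L := by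
  have hc : (z.take (P.cap n L)).length ≤ P.cap n L := by rw [List.length_take]; exact min_le_left _ _
  have hcap : 2 * P.cap n L + 2 ≤ P.W n L := by unfold cap; omega
  rw [enc, length_boolPair, List.length_replicate]; omega

/-- `enc` is injective (the padding is determined by the first component). [folklore] -/
theorem enc_injective_iff {L : ℕ} (z z' : List Bool) :
    P.enc n L z = P.enc n L z' ↔ z.take (P.cap n L) = z'.take (P.cap n L) := by
  constructor
  · intro h
    have := boolPair_injective (a₁ := (_, _)) (a₂ := (_, _)) h
    simp only [Prod.mk.injEq] at this
    exact this.1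
  · intro h; rw [enc, enc, h]

/-- On a short string the cap is inactive. [folklore] -/
theorem take_cap_eq {L : ℕ} {z : List Bool} (hz : 2 * z.length + 2 ≤ P.W n L) : z.take (P.cap n L) = z :=
  List.take_of_length_le (by unfold cap; omega)

/-- `|aOf x| = t` once `t ≤ |x|`. [folklore] -/
theorem length_aOf {x : List Bool} (hx : P.tLen n ≤ x.length) : (P.aOf n x).length = P.tLen n := by
  rw [aOf, List.length_take, min_eq_left hx]

/-- `|bOf x| = t` once `2t ≤ |x|`. [folklore] -/
theorem length_bOf {x : List Bool} (hx : 2 * P.tLen n ≤ x.length) : (P.bOf n x).length = P.tLen n := by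
  rw [bOf, List.length_take, List.length_drop, min_eq_left (by omega)]

/-- **`core` is length preserving** on inputs of length `≥ 2t + 2`. [folklore] -/
theorem length_core {x : List Bool} (hx : 2 * P.tLen n + 2 ≤ x.length) : (P.core n x).length = x.length := by
  rw [core, List.length_append, List.length_append, P.length_aOf (by omega), P.length_bOf (by omega),
    P.length_enc (by unfold W; omega)]
  unfold W; omega

/-- **Reading an image of `core`**: for `x, x'` of the same length `≥ 2t + 2`, `core n x' = core n x` iff the two
guess fields agree and the capped samples agree. [folklore] -/
theorem core_eq_core_iff {x x' : List Bool} (hx : 2 * P.tLen n + 2 ≤ x.length) (hlen : x'.length = x.length) :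
    P.core n x' = P.core n x ↔ P.aOf n x' = P.aOf n x ∧ P.bOf n x' = P.bOf n x ∧
      (P.zOf n x').take (P.cap n x.length) = (P.zOf n x).take (P.cap n x.length) := by
  have ha : (P.aOf n x').length = (P.aOf n x).length := by rw [P.length_aOf (by omega), P.length_aOf (by omega)]
  have hb : (P.bOf n x').length = (P.bOf n x).length := by rw [P.length_bOf (by omega), P.length_bOf (by omega)]
  constructor
  · intro h
    rw [core, core, hlen, List.append_assoc, List.append_assoc] at h
    obtain ⟨h1, h2⟩ := List.append_inj h ha
    obtain ⟨h3, h4⟩ := List.append_inj h2 hb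
    exact ⟨h1, h3, (P.enc_injective_iff _ _).1 h4⟩
  · rintro ⟨h1, h2, h3⟩
    rw [core, core, hlen, h1, h2, enc, enc, h3]

end Core

/-! ### The length-preserving function `f̃` -/

/-- **`f̃`**: at a length `L` with `Q (nPar L) ≤ L` the map `core (nPar L)`, elsewhere (finitely many short
lengths) the identity. [cite: Goldreich2001, §3.8 Exercise 11 (guideline) with §2.2.3.2] -/
def ftil (x : List Bool) : List Bool := if P.Q (P.nPar x.length) ≤ x.length then P.core (P.nPar x.length) x else x

/-- `f̃ = core (nPar L)` on the served lengths. [folklore] -/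
theorem ftil_eq {x : List Bool} (h : P.Q (P.nPar x.length) ≤ x.length) : P.ftil x = P.core (P.nPar x.length) x := if_pos h

/-- Every length `L ≥ Q 0` is served. [folklore] -/
theorem served {L : ℕ} (hL : P.Q 0 ≤ L) : P.Q (P.nPar L) ≤ L := P.Q_nPar_le hL

/-- On a served length the fields fit: `2t + 1 + R + 1 ≤ L`. [folklore] -/
theorem fields_le {L : ℕ} (h : P.Q (P.nPar L) ≤ L) : 2 * P.tLen (P.nPar L) + 1 + P.R (P.nPar L) + 1 ≤ L :=
  (P.fields_le_Q _).trans h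

/-- **`f̃` is length preserving.** [folklore] -/
theorem isLengthPreserving_ftil : IsLengthPreserving P.ftil := by
  intro x
  unfold ftil
  split_ifs with h
  · exact P.length_core (by have := P.fields_le h; omega)
  · rfl

/-! ### The slice -/

section Slice

variable (n : ℕ)

/-- The selector bit of a rest string `rest = σ ‖ r ‖ junk`. [folklore] -/
def sgR (rest : List Bool) : Bool := rest.getD 0 false

/-- The coins in force on the slice: `(r ↾ ℓ_σ(n))`, `r` = the `R n` bits after `σ`. [folklore] -/
def coinsR (rest : List Bool) : List Bool := ((rest.drop 1).take (P.R n)).take (P.ell (sgR rest) n)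

/-- **The sample on the slice**: `zOfRest n rest = S_σ(1ⁿ; r ↾ ℓ_σ(n))`. [cite: Goldreich2001, §3.8 Exercise 11 (guideline)] -/
def zOfRest (rest : List Bool) : List Bool := (P.S (sgR rest)).run n (P.coinsR n rest)

/-- The slice prefix `bits ℓ₀(n) ‖ bits ℓ₁(n)`. [folklore] -/
def slicePref : List Bool := bitsT (P.tLen n) (P.ell false n) ++ bitsT (P.tLen n) (P.ell true n)

variable {n}

/-- Under the coin bound the slice prefix has length `2t`. [folklore] -/
theorem length_slicePref (hc : ∀ σ, P.ell σ n ≤ P.pc.eval n) : (P.slicePref n).length = 2 * P.tLen n := by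
  have h0 := length_bitsT ((hc false).trans_lt (P.lt_two_pow_tLen n))
  have h1 := length_bitsT ((hc true).trans_lt (P.lt_two_pow_tLen n))
  rw [slicePref, List.length_append, h0, h1, two_mul]

/-- **`core` on the slice**: `core n (slicePref ‖ rest) = slicePref ‖ enc (zOfRest rest)`. [folklore] -/
theorem core_slice (hc : ∀ σ, P.ell σ n ≤ P.pc.eval n) (rest : List Bool) :
    P.core n (P.slicePref n ++ rest) = P.slicePref n ++ P.enc n (P.slicePref n ++ rest).length (P.zOfRest n rest) := by
  have hl0 := length_bitsT ((hc false).trans_lt (P.lt_two_pow_tLen n))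
  have hl1 := length_bitsT ((hc true).trans_lt (P.lt_two_pow_tLen n))
  have hsp := P.length_slicePref hc
  have ha : P.aOf n (P.slicePref n ++ rest) = bitsT (P.tLen n) (P.ell false n) := by
    rw [aOf, slicePref, List.append_assoc, List.take_left' hl0]
  have hb : P.bOf n (P.slicePref n ++ rest) = bitsT (P.tLen n) (P.ell true n) := by
    rw [bOf, slicePref, List.append_assoc, List.drop_left' hl0, List.take_left' hl1]
  have hsg : P.sgOf n (P.slicePref n ++ rest) = sgR rest := by
    rw [sgOf, sgR, List.getD_eq_getElem?_getD, List.getD_eq_getElem?_getD, List.getElem?_append_right (by omega), hsp,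
      Nat.sub_self]
  have hr : P.rOf n (P.slicePref n ++ rest) = (rest.drop 1).take (P.R n) := by
    rw [rOf, ← hsp, ← List.drop_drop, List.drop_left]
  have hj : P.jOf n (P.slicePref n ++ rest) = P.ell (sgR rest) n := by
    rw [jOf, hsg, ha, hb]
    cases sgR rest <;> simp
  have hz : P.zOf n (P.slicePref n ++ rest) = P.zOfRest n rest := by
    rw [zOf, hsg, hr, hj, zOfRest, coinsR]
  rw [core, ha, hb, hz, slicePref]

/-- Membership in a slice fibre: for `rest, rest'` of the same length, `core n (slicePref ‖ rest') = core n
(slicePref ‖ rest)` iff the (capped) samples agree. [folklore] -/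
theorem core_slice_eq_iff (hc : ∀ σ, P.ell σ n ≤ P.pc.eval n) {rest rest' : List Bool} (hlen : rest'.length = rest.length) :
    P.core n (P.slicePref n ++ rest') = P.core n (P.slicePref n ++ rest) ↔
      (P.zOfRest n rest').take (P.cap n ((P.slicePref n ++ rest).length)) =
        (P.zOfRest n rest).take (P.cap n ((P.slicePref n ++ rest).length)) := by
  have hL : (P.slicePref n ++ rest').length = (P.slicePref n ++ rest).length := by simp [hlen]
  rw [P.core_slice hc, P.core_slice hc, hL]
  constructor
  · intro h
    exact (P.enc_injective_iff _ _).1 (List.append_cancel_left h)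
  · intro h
    rw [enc, enc, h]

end Slice

/-! ### Averages over the slice rest-space -/

/-- `E_{U_1} g = ½(g 0 + g 1)` (private copy of `uniformAvg_one`, `ComPRGHiding.lean`). [folklore] -/
private theorem uniformAvg_one' (g : List Bool → ℝ) : uniformAvg 1 g = 2⁻¹ * (g [false] + g [true]) := by
  show (∑ x : List.Vector Bool 1, g x.toList) / 2 ^ 1 = _
  have huniv : (Finset.univ : Finset (List.Vector Bool 1)) = {⟨[false], rfl⟩, ⟨[true], rfl⟩} := by
    ext v
    simp only [Finset.mem_univ, Finset.mem_insert, Finset.mem_singleton, true_iff]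
    obtain ⟨l, hl⟩ := v
    match l, hl with
    | [b], _ => cases b <;> simp
  rw [huniv, Finset.sum_pair (by decide)]
  simp only [List.Vector.toList_mk, pow_one]
  ring

/-- A function of a prefix of the coins (private copy of `uniformAvg_take'`, `SchemesProofs.lean`). [folklore] -/
private theorem uniformAvg_take'' (κ e : ℕ) (f : List Bool → ℝ) : uniformAvg (κ + e) (fun r => f (r.take κ)) = uniformAvg κ f := by
  have h := uniformAvg_add κ e (fun u _ => f u)
  simp only [uniformAvg_const] at h
  exact h

/-- **The two halves of the rest-space.** On rest strings `σ ‖ r ‖ junk` of length `1 + (R n + J)`, the half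
`σ = σ₀` produces exactly the samples of `S_{σ₀}` on `ℓ_{σ₀}(n)` uniform coins:
`E_rest[[σ = σ₀] · φ(zOfRest rest)] = ½ · E_{r₀ ← U_{ℓ_{σ₀}(n)}}[φ(S_{σ₀}(1ⁿ; r₀))]` (the coins in force are a
prefix of `r`, `ℓ_{σ₀}(n) ≤ R n`; the other coins average out). [cite: Goldreich2001, Def. 3.2.5 (`S(1ⁿ)` distributed as `Xₙ`)] -/
theorem uniformAvg_slice {n : ℕ} (hc : ∀ σ, P.ell σ n ≤ P.pc.eval n) (σ₀ : Bool) (J : ℕ) (φ : List Bool → ℝ) :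
    uniformAvg (1 + (P.R n + J)) (fun rest => (if sgR rest = σ₀ then (1 : ℝ) else 0) * φ (P.zOfRest n rest)) =
      2⁻¹ * uniformAvg (P.ell σ₀ n) (fun r₀ => φ ((P.S σ₀).run n r₀)) := by
  set Φ : List Bool → List Bool → ℝ := fun u w =>
    (if u.getD 0 false = σ₀ then (1 : ℝ) else 0) *
      φ ((P.S (u.getD 0 false)).run n ((w.take (P.R n)).take (P.ell (u.getD 0 false) n))) with hΦ
  have hkey : ∀ rest : List Bool, (if sgR rest = σ₀ then (1 : ℝ) else 0) * φ (P.zOfRest n rest) = Φ (rest.take 1) (rest.drop 1) := by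
    intro rest
    cases rest <;> rfl
  have hℓ : ∀ σ, P.ell σ n ≤ P.R n := fun σ => hc σ
  have hhalf : ∀ σ, uniformAvg (P.R n + J) (fun w => φ ((P.S σ).run n ((w.take (P.R n)).take (P.ell σ n)))) =
      uniformAvg (P.ell σ n) (fun r₀ => φ ((P.S σ).run n r₀)) := by
    intro σ
    obtain ⟨e, he⟩ := Nat.exists_eq_add_of_le (show P.ell σ n ≤ P.R n + J from (hℓ σ).trans (Nat.le_add_right _ _))
    rw [he, ← uniformAvg_take'' (P.ell σ n) e (fun r₀ => φ ((P.S σ).run n r₀))]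
    refine uniformAvg_congr fun w _ => ?_
    rw [List.take_take, min_eq_left (hℓ σ)]
  rw [uniformAvg_congr (fun rest _ => hkey rest), uniformAvg_add 1 (P.R n + J) Φ, uniformAvg_one']
  cases σ₀ with
  | false =>
    simp only [hΦ, List.getD_cons_zero, if_true, one_mul, Bool.true_eq_false, if_false, zero_mul, uniformAvg_const,
      add_zero]
    rw [hhalf false]
  | true =>
    simp only [hΦ, List.getD_cons_zero, if_true, one_mul, Bool.false_eq_true, if_false, zero_mul, uniformAvg_const,
      zero_add]
    rw [hhalf true]

/-- The output law of a randomized algorithm is the push-forward of `U_m`, `m` its coin count (private copy of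
`outputPMF_eq_map_uniformBits`, `CommitmentsSignaturesProofs.lean`). [folklore] -/
private theorem outputPMF_eq_map_uniformBits' {α β : Type} (A : RandAlg α β) (ea : α → List Bool) (x : α)
    {m : ℕ} (hm : A.coinLen (ea x).length = m) : A.outputPMF ea x = (uniformBits m).map (A.run x) := by
  subst hm
  rw [uniformBits, PMF.map_comp]
  rfl

/-- The output law of a sampler on `1ⁿ` is the push-forward of `U_{coinLen n}` (`|1ⁿ| = n`). [folklore] -/
theorem outputPMF_unary_eq (A : RandAlg ℕ (List Bool)) (n : ℕ) :
    A.outputPMF unaryEncodeNat n = (uniformBits (A.coinLen n)).map (A.run n) :=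
  outputPMF_eq_map_uniformBits' A unaryEncodeNat n (by simp [Complexity.unaryEncodeNat_eq_replicate])

end Params

/-! ### The program for `f̃` -/

namespace FProg

open Complexity.Brick Complexity.Plumb Complexity.OracleCompose

variable (P : Params)

/-! #### A clocked search for the largest `k ≤ |x|` with `p(k) ≤ |x|` (pattern of `CommitmentOneWay.FProg.mFn`) -/

section Search

variable (p : Polynomial ℕ)

/-- The target of the search: the largest `k ≤ L` with `p k ≤ L`. [folklore] -/
def maxBelow (L : ℕ) : ℕ := Nat.findGreatest (fun k => p.eval k ≤ L) L

/-- The search step: `k ↦ k + 1` while `p(k+1) ≤ L`. [folklore] -/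
def sstep (L k : ℕ) : ℕ := if p.eval (k + 1) ≤ L then k + 1 else k

/-- The condition `[|x| + 1 ≤ p(k+1)]` (= "stop") on the state `⟨x, 1ᵏ⟩`. [folklore] -/
def sCond : List Bool → List Bool := lenLeFn (p.comp (X + 1)) ∘ fanoutFn sndF (List.cons true ∘ fstF)

/-- One round of the search on `⟨x, 1ᵏ⟩`. [folklore] -/
def sRound : List Bool → List Bool := fanoutFn fstF (iteFn (sCond p) sndF (List.cons true ∘ sndF))

/-- Value of the condition. [folklore] -/
theorem sCond_state (x : List Bool) (k : ℕ) : sCond p (boolPair x (ones k)) = [decide (x.length + 1 ≤ p.eval (k + 1))] := by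
  simp [sCond, lenLeFn_boolPair]

/-- Value of the round. [folklore] -/
theorem sRound_state (x : List Bool) (k : ℕ) : sRound p (boolPair x (ones k)) = boolPair x (ones (sstep p x.length k)) := by
  unfold sRound sstep
  rw [fanoutFn_apply, fstF_boolPair]
  by_cases h : p.eval (k + 1) ≤ x.length
  · rw [iteFn_apply_false (by rw [sCond_state, decide_eq_false (by omega)]), if_pos h]
    simp [List.replicate_succ]
  · rw [iteFn_apply_true (by rw [sCond_state, decide_eq_true (by omega)]), if_neg h]
    simp

/-- Additive growth of the round. [folklore] -/
theorem length_sRound_le (w : List Bool) : (sRound p w).length ≤ w.length + 3 := by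
  have h1 := length_boolUnpair_parts_le w
  unfold sRound
  rcases lenLeFn_eq_or (p.comp (X + 1)) (fanoutFn sndF (List.cons true ∘ fstF) w) with h | h
  · rw [fanoutFn_apply, iteFn_apply_true (by simpa [sCond] using h)]
    simp only [length_boolPair, fstF, sndF]; omega
  · rw [fanoutFn_apply, iteFn_apply_false (by simpa [sCond] using h)]
    simp only [length_boolPair, fstF, sndF, Function.comp_apply, List.length_cons]; omega

/-- **The search computes `maxBelow`**: after `j ≤ L` rounds the counter is `min j (maxBelow L)` (evaluation of
an `ℕ`-polynomial is monotone). [folklore] -/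
theorem iterate_sstep (L : ℕ) : ∀ j, j ≤ L → (sstep p L)^[j] 0 = min j (maxBelow p L)
  | 0, _ => by simp
  | j + 1, hj => by
    rw [Function.iterate_succ_apply', iterate_sstep L j (by omega)]
    have hGm : maxBelow p L ≤ L := Nat.findGreatest_le L
    have hG2 : ∀ k, maxBelow p L < k → k ≤ L → ¬ p.eval k ≤ L := fun k h1 h2 =>
      Nat.findGreatest_is_greatest (P := fun k => p.eval k ≤ L) h1 h2
    unfold sstep
    by_cases hjG : j < maxBelow p L
    · have hG1 : p.eval (maxBelow p L) ≤ L := by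
        have hne : maxBelow p L ≠ 0 := by omega
        exact Nat.findGreatest_of_ne_zero (m := maxBelow p L) rfl hne
      rw [min_eq_left hjG.le, if_pos ((natPoly_eval_mono p (by omega)).trans hG1), min_eq_left (by omega)]
    · rw [min_eq_right (by omega), if_neg (hG2 _ (Nat.lt_succ_of_le (by omega)) (by omega)), min_eq_right (by omega)]

/-- Rounds of the search on a state. [folklore] -/
theorem iterate_sRound (x : List Bool) : ∀ j, (sRound p)^[j] (boolPair x (ones 0)) = boolPair x (ones ((sstep p x.length)^[j] 0))
  | 0 => rfl
  | j + 1 => by rw [Function.iterate_succ_apply', iterate_sRound x j, sRound_state, Function.iterate_succ_apply']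

/-- **`searchF p x = 1^{maxBelow p |x|}`.** [folklore] -/
def searchF : List Bool → List Bool :=
  sndF ∘ (fun z => (sRound p)^[X.eval (boolUnpair z).1.length] z) ∘ fanoutFn id (fun _ => [])

/-- Value of `searchF`. [folklore] -/
@[simp] theorem searchF_apply (x : List Bool) : searchF p x = ones (maxBelow p x.length) := by
  have h := iterate_sRound p x x.length
  rw [iterate_sstep p x.length x.length le_rfl, min_eq_right (show maxBelow p x.length ≤ x.length from Nat.findGreatest_le x.length)] at h
  simp only [searchF, Function.comp_apply, fanoutFn_apply, id, boolUnpair_boolPair, eval_X]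
  rw [show (boolPair x [] : List Bool) = boolPair x (ones 0) from rfl, h, sndF_boolPair]

/-- `searchF p ∈ FP`. [folklore] -/
theorem searchF_mem_FP : searchF p ∈ FP :=
  comp_mem_FP sndF_mem_FP (comp_mem_FP
    (iterate_mem_FP (fanoutFn_mem_FP fstF_mem_FP (iteFn_mem_FP
      (comp_mem_FP (lenLeFn_mem_FP _) (fanoutFn_mem_FP sndF_mem_FP (comp_mem_FP (cons_mem_FP true) fstF_mem_FP)))
      sndF_mem_FP (comp_mem_FP (cons_mem_FP true) sndF_mem_FP))) 3 (length_sRound_le p) X)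
    (fanoutFn_mem_FP OracleCompose.id_mem_FP (const_mem_FP [])))

end Search

/-- **`nF x = 1^{nPar |x|}`.** [folklore] -/
def nF : List Bool → List Bool := searchF P.Qpoly

/-- Value of `nF`. [folklore] -/
@[simp] theorem nF_apply (x : List Bool) : nF P x = ones (P.nPar x.length) := searchF_apply _ _

/-- `nF ∈ FP`. [folklore] -/
theorem nF_mem_FP : nF P ∈ FP := searchF_mem_FP _

/-! #### The sampler as a string function -/

/-- `sampStr S ⟨u, s⟩ = S(1^{|u|}; s)`. [folklore] -/
noncomputable def sampStr (S : RandAlg ℕ (List Bool)) : List Bool → List Bool := fun w => S.run (fstF w).length (sndF w)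

/-- The normaliser `⟨u, s⟩ ↦ ⟨1^{|u|}, s⟩` (the sampler's input code). [folklore] -/
noncomputable def nrmFn : List Bool → List Bool := fanoutFn (onesFn ∘ fstF) sndF

/-- `nrmFn` produces the sampler's input code. [folklore] -/
theorem nrmFn_apply (w : List Bool) : nrmFn w = boolPair (unaryEncodeNat (fstF w).length) (sndF w) := by
  simp [nrmFn, onesFn]

/-- **`sampStr S ∈ FP`** for a polynomial-time sampler. [folklore] -/
theorem sampStr_mem_FP {S : RandAlg ℕ (List Bool)} (hS : S.IsPolyTime unaryEncodeNat id) : sampStr S ∈ FP := by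
  have hnrm : nrmFn ∈ FP := fanoutFn_mem_FP (comp_mem_FP onesFn_mem_FP fstF_mem_FP) sndF_mem_FP
  have hdec : PolyTimeComputable (id : List Bool → List Bool)
      (fun p : ℕ × List Bool => boolPair (unaryEncodeNat p.1) p.2) (fun w => ((fstF w).length, sndF w)) :=
    PolyTimeComputable.of_encode_eq (f := nrmFn) (id : List Bool → List Bool) (fun _ => rfl)
      (fun w => by rw [nrmFn_apply]; rfl) hnrm
  exact PolyTimeComputable.comp_holds hS.1 hdec

/-- `sampStr S ⟨1ⁿ, s⟩ = S(1ⁿ; s)`. [folklore] -/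
@[simp] theorem sampStr_boolPair (S : RandAlg ℕ (List Bool)) (n : ℕ) (s : List Bool) :
    sampStr S (boolPair (ones n) s) = S.run n s := by
  simp [sampStr, ones]

/-! #### The pieces of `core` -/

/-- `1^{t(n)}`. [folklore] -/
noncomputable def tU : List Bool → List Bool := List.cons true ∘ logFn ∘ polyFn P.pc ∘ nF P
/-- `1^{2t(n)}`. [folklore] -/
noncomputable def ttU : List Bool → List Bool := concatFn ∘ fanoutFn (tU P) (tU P)
/-- `a = x ↾ t`. [folklore] -/
noncomputable def aF : List Bool → List Bool := takeFn ∘ fanoutFn (tU P) id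
/-- `b = (x ⇂ t) ↾ t`. [folklore] -/
noncomputable def bF : List Bool → List Bool := takeFn ∘ fanoutFn (tU P) (dropFn ∘ fanoutFn (tU P) id)
/-- The selector condition `[x[2t] = 1]` (one bit on every input). [folklore] -/
noncomputable def sgC : List Bool → List Bool := eqPairFn ∘ fanoutFn (bitAtFn ∘ fanoutFn (ttU P) id) (fun _ => [true])
/-- `r = (x ⇂ (2t+1)) ↾ R(n)`. [folklore] -/
noncomputable def rF : List Bool → List Bool :=
  takeFn ∘ fanoutFn (polyFn P.pc ∘ nF P) (dropFn ∘ fanoutFn (List.cons true ∘ ttU P) id)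
/-- The guess bits in force, `σ ? b : a`. [folklore] -/
noncomputable def gF : List Bool → List Bool := iteFn (sgC P) (bF P) (aF P)
/-- `1^{j}` (ruler `1^{2 pc n + 2} ⊇ 1^{2^t}`). [folklore] -/
noncomputable def jU : List Bool → List Bool := binToUnaryFn ∘ fanoutFn (polyFn (C 2 * P.pc + C 2) ∘ nF P) (gF P)
/-- The coins `r ↾ j`. [folklore] -/
noncomputable def cF : List Bool → List Bool := takeFn ∘ fanoutFn (jU P) (rF P)
/-- The sample `z = S_σ(1ⁿ; r ↾ j)`. [folklore] -/
noncomputable def zF : List Bool → List Bool :=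
  iteFn (sgC P) (sampStr P.S1 ∘ fanoutFn (nF P) (cF P)) (sampStr P.S0 ∘ fanoutFn (nF P) (cF P))
/-- `1^{W}`, `W = |x| − 2t`. [folklore] -/
noncomputable def WU : List Bool → List Bool := dropFn ∘ fanoutFn (ttU P) onesFn
/-- `1^{cap}`, `cap = ⌊(W − 2)/2⌋`. [folklore] -/
noncomputable def capU : List Bool → List Bool := halfFn ∘ dropFn ∘ fanoutFn (fun _ => ones 2) (WU P)
/-- The capped sample `z ↾ cap`. [folklore] -/
noncomputable def zcF : List Bool → List Bool := takeFn ∘ fanoutFn (capU P) (zF P)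
/-- The padding `0^{W − (2|z ↾ cap| + 2)}`. [folklore] -/
noncomputable def padF : List Bool → List Bool :=
  Kannan.zerosFn ∘ dropFn ∘ fanoutFn (concatFn ∘ fanoutFn (concatFn ∘ fanoutFn (onesFn ∘ zcF P) (onesFn ∘ zcF P)) (fun _ => ones 2)) (WU P)
/-- The code field `⟨z ↾ cap, 0…0⟩`. [folklore] -/
noncomputable def encF : List Bool → List Bool := fanoutFn (zcF P) (padF P)
/-- The program for `core`. [folklore] -/
noncomputable def coreF : List Bool → List Bool := concatFn ∘ fanoutFn (concatFn ∘ fanoutFn (aF P) (bF P)) (encF P)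
/-- The guard `[Q(nPar |x|) ≤ |x|]`. [folklore] -/
noncomputable def guardC : List Bool → List Bool := lenLeFn X ∘ fanoutFn id (polyFn P.Qpoly ∘ nF P)
/-- **The program for `f̃`.** [folklore] -/
noncomputable def ftilF : List Bool → List Bool := iteFn (guardC P) (coreF P) id

variable {P}

/-- `onesFn w = 1^{|w|}`. [folklore] -/
private theorem onesFn_eq_ones (w : List Bool) : onesFn w = ones w.length := by
  simp [onesFn, Complexity.unaryEncodeNat_eq_replicate, ones]

section Values

variable (x : List Bool)

local notation "nn" => P.nPar x.length

/-- `tU x = 1^{t}`. [folklore] -/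
theorem tU_apply : tU P x = ones (P.tLen nn) := by
  rw [tU, Function.comp_apply, Function.comp_apply, Function.comp_apply, nF_apply, polyFn_apply, logFn]
  simp [ones, Params.tLen, HILL.bLen, List.replicate_succ]

/-- `ttU x = 1^{2t}`. [folklore] -/
theorem ttU_apply : ttU P x = ones (2 * P.tLen nn) := by
  rw [ttU, Function.comp_apply, fanoutFn_apply, tU_apply, concatFn_boolPair, Com.ones_append, two_mul]

/-- `aF x = a`. [folklore] -/
theorem aF_apply : aF P x = P.aOf nn x := by
  rw [aF, Function.comp_apply, fanoutFn_apply, tU_apply, takeFn_boolPair]; simp [ones, Params.aOf]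

/-- `bF x = b`. [folklore] -/
theorem bF_apply : bF P x = P.bOf nn x := by
  rw [bF, Function.comp_apply, fanoutFn_apply, tU_apply, Function.comp_apply, fanoutFn_apply, tU_apply, dropFn_boolPair,
    takeFn_boolPair]; simp [ones, Params.bOf]

/-- `sgC x = [σ]`. [folklore] -/
theorem sgC_apply : sgC P x = [P.sgOf nn x] := by
  rw [sgC, Function.comp_apply, fanoutFn_apply, Function.comp_apply, fanoutFn_apply, ttU_apply, bitAtFn_boolPair, eqPairFn_boolPair]
  simp only [ones, List.length_replicate, id, Params.sgOf, List.getD_eq_getElem?_getD]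
  rcases lt_or_ge (2 * P.tLen nn) x.length with h | h
  · rw [List.take_one_drop_eq_of_lt_length h, List.getElem?_eq_getElem h]; simp
  · rw [List.drop_of_length_le h, List.getElem?_eq_none h]; simp

/-- `rF x = r`. [folklore] -/
theorem rF_apply : rF P x = P.rOf nn x := by
  rw [rF, Function.comp_apply, fanoutFn_apply, Function.comp_apply, nF_apply, polyFn_apply, Function.comp_apply, fanoutFn_apply,
    Function.comp_apply, ttU_apply, dropFn_boolPair, takeFn_boolPair]
  simp [ones, Params.rOf, Params.R]

/-- `gF x` = the guess bits in force. [folklore] -/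
theorem gF_apply : gF P x = (if P.sgOf nn x then P.bOf nn x else P.aOf nn x) := by
  rw [gF, iteFn_apply (sgC_apply x), bF_apply, aF_apply]

/-- `jU x = 1^{j}`. [folklore] -/
theorem jU_apply : jU P x = ones (P.jOf nn x) := by
  have hlt : P.jOf nn x < 2 * P.pc.eval nn + 2 := by
    refine lt_of_lt_of_le ?_ (P.two_pow_tLen_le nn)
    unfold Params.jOf
    refine (bitsToNat_lt _).trans_le (Nat.pow_le_pow_right (by norm_num) ?_)
    split_ifs
    · rw [Params.bOf, List.length_take]; exact min_le_left _ _
    · rw [Params.aOf, List.length_take]; exact min_le_left _ _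
  rw [jU, Function.comp_apply, fanoutFn_apply, Function.comp_apply, nF_apply, polyFn_apply, gF_apply, binToUnaryFn_boolPair]
  simp only [ones, List.length_replicate, eval_add, eval_mul, eval_C]
  rw [min_eq_left (by exact hlt.le)]
  rfl

/-- `cF x = r ↾ j`. [folklore] -/
theorem cF_apply : cF P x = (P.rOf nn x).take (P.jOf nn x) := by
  rw [cF, Function.comp_apply, fanoutFn_apply, jU_apply, rF_apply, takeFn_boolPair]; simp [ones]

/-- `zF x = z`. [folklore] -/
theorem zF_apply : zF P x = P.zOf nn x := by
  rw [zF, iteFn_apply (sgC_apply x)]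
  unfold Params.zOf Params.S
  split_ifs with h <;> rw [Function.comp_apply, fanoutFn_apply, nF_apply, cF_apply, sampStr_boolPair]

/-- `WU x = 1^{W}`. [folklore] -/
theorem WU_apply : WU P x = ones (P.W nn x.length) := by
  rw [WU, Function.comp_apply, fanoutFn_apply, ttU_apply, onesFn_eq_ones, dropFn_boolPair]
  simp [ones, Params.W]

/-- `capU x = 1^{cap}`. [folklore] -/
theorem capU_apply : capU P x = ones (P.cap nn x.length) := by
  rw [capU, Function.comp_apply, Function.comp_apply, fanoutFn_apply, WU_apply, dropFn_boolPair, halfFn]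
  simp [ones, Params.cap]

/-- `zcF x = z ↾ cap`. [folklore] -/
theorem zcF_apply : zcF P x = (P.zOf nn x).take (P.cap nn x.length) := by
  rw [zcF, Function.comp_apply, fanoutFn_apply, capU_apply, zF_apply, takeFn_boolPair]; simp [ones]

/-- `padF x` = the padding. [folklore] -/
theorem padF_apply : padF P x = List.replicate (P.W nn x.length - (2 * ((P.zOf nn x).take (P.cap nn x.length)).length + 2)) false := by
  simp only [padF, Function.comp_apply, fanoutFn_apply, zcF_apply, onesFn_eq_ones, concatFn_boolPair, Com.ones_append,
    WU_apply, dropFn_boolPair, Kannan.zerosFn_apply, ones, List.length_replicate, List.length_drop, two_mul]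

/-- `encF x = enc (z)`. [folklore] -/
theorem encF_apply : encF P x = P.enc nn x.length (P.zOf nn x) := by
  rw [encF, fanoutFn_apply, zcF_apply, padF_apply, Params.enc]

/-- **`coreF x = core (nPar |x|) x`.** [folklore] -/
theorem coreF_apply : coreF P x = P.core nn x := by
  rw [coreF, Function.comp_apply, fanoutFn_apply, Function.comp_apply, fanoutFn_apply, aF_apply, bF_apply, encF_apply,
    concatFn_boolPair, concatFn_boolPair, Params.core]

/-- `guardC x = [Q(nPar |x|) ≤ |x|]`. [folklore] -/
theorem guardC_apply : guardC P x = [decide (P.Q nn ≤ x.length)] := by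
  rw [guardC, Function.comp_apply, fanoutFn_apply, Function.comp_apply, nF_apply, polyFn_apply, lenLeFn_boolPair]
  simp [ones, Params.Q, id]

/-- **The program computes `f̃`.** [folklore] -/
theorem ftilF_apply : ftilF P x = P.ftil x := by
  rw [ftilF, iteFn_apply (guardC_apply x), Params.ftil]
  by_cases h : P.Q nn ≤ x.length
  · rw [decide_eq_true h, if_pos rfl, if_pos h, coreF_apply]
  · rw [decide_eq_false h, if_neg h]; simp

end Values

/-- **`ftilF ∈ FP`** for polynomial-time samplers. [Arora–Barak 2009, §1.3] [folklore] -/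
theorem ftilF_mem_FP (h0 : P.S0.IsPolyTime unaryEncodeNat id) (h1 : P.S1.IsPolyTime unaryEncodeNat id) : ftilF P ∈ FP := by
  have hn : nF P ∈ FP := nF_mem_FP P
  have ht : tU P ∈ FP := comp_mem_FP (cons_mem_FP true) (comp_mem_FP logFn_mem_FP (comp_mem_FP (polyFn_mem_FP _) hn))
  have htt : ttU P ∈ FP := comp_mem_FP concatFn_mem_FP (fanoutFn_mem_FP ht ht)
  have ha : aF P ∈ FP := comp_mem_FP takeFn_mem_FP (fanoutFn_mem_FP ht OracleCompose.id_mem_FP)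
  have hb : bF P ∈ FP := comp_mem_FP takeFn_mem_FP (fanoutFn_mem_FP ht (comp_mem_FP dropFn_mem_FP (fanoutFn_mem_FP ht OracleCompose.id_mem_FP)))
  have hsg : sgC P ∈ FP := comp_mem_FP eqPairFn_mem_FP (fanoutFn_mem_FP (comp_mem_FP bitAtFn_mem_FP
    (fanoutFn_mem_FP htt OracleCompose.id_mem_FP)) (const_mem_FP _))
  have hr : rF P ∈ FP := comp_mem_FP takeFn_mem_FP (fanoutFn_mem_FP (comp_mem_FP (polyFn_mem_FP _) hn)
    (comp_mem_FP dropFn_mem_FP (fanoutFn_mem_FP (comp_mem_FP (cons_mem_FP true) htt) OracleCompose.id_mem_FP)))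
  have hg : gF P ∈ FP := iteFn_mem_FP hsg hb ha
  have hj : jU P ∈ FP := comp_mem_FP binToUnaryFn_mem_FP (fanoutFn_mem_FP (comp_mem_FP (polyFn_mem_FP _) hn) hg)
  have hc : cF P ∈ FP := comp_mem_FP takeFn_mem_FP (fanoutFn_mem_FP hj hr)
  have hz : zF P ∈ FP := iteFn_mem_FP hsg (comp_mem_FP (sampStr_mem_FP h1) (fanoutFn_mem_FP hn hc))
    (comp_mem_FP (sampStr_mem_FP h0) (fanoutFn_mem_FP hn hc))
  have hW : WU P ∈ FP := comp_mem_FP dropFn_mem_FP (fanoutFn_mem_FP htt onesFn_mem_FP)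
  have hcap : capU P ∈ FP := comp_mem_FP halfFn_mem_FP (comp_mem_FP dropFn_mem_FP (fanoutFn_mem_FP (const_mem_FP _) hW))
  have hzc : zcF P ∈ FP := comp_mem_FP takeFn_mem_FP (fanoutFn_mem_FP hcap hz)
  have hpad : padF P ∈ FP := comp_mem_FP Kannan.zerosFn_mem_FP (comp_mem_FP dropFn_mem_FP (fanoutFn_mem_FP
    (comp_mem_FP concatFn_mem_FP (fanoutFn_mem_FP (comp_mem_FP concatFn_mem_FP (fanoutFn_mem_FP
      (comp_mem_FP onesFn_mem_FP hzc) (comp_mem_FP onesFn_mem_FP hzc))) (const_mem_FP _))) hW))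
  have henc : encF P ∈ FP := fanoutFn_mem_FP hzc hpad
  have hcore : coreF P ∈ FP := comp_mem_FP concatFn_mem_FP (fanoutFn_mem_FP (comp_mem_FP concatFn_mem_FP (fanoutFn_mem_FP ha hb)) henc)
  have hguard : guardC P ∈ FP := comp_mem_FP (lenLeFn_mem_FP _) (fanoutFn_mem_FP OracleCompose.id_mem_FP (comp_mem_FP (polyFn_mem_FP _) hn))
  exact iteFn_mem_FP hguard hcore OracleCompose.id_mem_FP

/-- **`f̃` is polynomial-time computable.** [cite: Goldreich2001, §3.8 Exercise 11 (guideline: the samplers are polynomial-time)] -/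
theorem ftil_polyTime (h0 : P.S0.IsPolyTime unaryEncodeNat id) (h1 : P.S1.IsPolyTime unaryEncodeNat id) :
    PolyTimeComputable id id P.ftil := by
  have h : P.ftil = ftilF P := funext fun x => (ftilF_apply x).symm
  rw [h]
  exact ftilF_mem_FP h0 h1

end FProg

end

end FarApartOWF

end Literature.Computability.Cryptography
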